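import Literature.NumberTheory.DiophantineGeometry.GenEllDivisorConductor
import Literature.NumberTheory.DiophantineGeometry.GenEllBDClasses
import HarnessLib

/-!
# [GenEll] Remark 1.5.1 on `ℙ¹`: the BD-class of `log-cond_D` depends only on `D_ℚ`

S. Mochizuki, *Arithmetic elliptic curves in general position*, Math. J. Okayama Univ. 52 (2010)
[cite: MochizukiGenEll2010, Rmk 1.5.1 pp.8–9] (kurims manuscript, Feb. 2009), read on the page:

> **Remark 1.5.1.** […] although the log-conductor function `log-cond_D` on `U_X(Q̄)` [cf.
> Definition 1.5, (iv)] may depend on the pair of `ℤ`-schemes `(X, D)`, one verifies immediately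
> that the BD-class of `log-cond_D` on `U_X(Q̄)` depends only on the pair of `ℚ`-schemes
> `(X_ℚ, D_ℚ)`. Indeed, this follows immediately from the observation that if `(X′, D′)` is another
> pair […], then any isomorphism `X′_ℚ ⥲ X_ℚ` that induces an isomorphism `D′_ℚ ⥲ D_ℚ` extends, for
> some finite set of prime numbers `Σ`, to an isomorphism `X′ ×_ℤ ℤ[Σ⁻¹] ⥲ X ×_ℤ ℤ[Σ⁻¹]` that
> induces an isomorphism `D′ ×_ℤ ℤ[Σ⁻¹] ⥲ D ×_ℤ ℤ[Σ⁻¹]`.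

This file PROVES the Remark at the tree's specialisation `X = ℙ¹` (`GenEllDivisorConductor.lean`,
whose module docstring records Rmk. 1.5.1 as "here, not typed"): an effective divisor of `ℙ¹_ℤ`
flat over `ℤ` is `V(M)` for a binary form `M`, recorded as `D : P1Divisor` by `m = M(t, 1) ∈ ℤ[t]`
and `N = deg M`. Two integral models `D`, `D′` have THE SAME REDUCED DIVISOR OVER `ℚ` iff each of
`M`, `M′` divides a constant multiple of a power of the other in `ℤ[T₀, T₁]` (Nullstellensatz for
binary forms, `ℚ[T₀,T₁]` factorial); we take this as the explicit CERTIFICATE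
`C a · m ^ n = u · m′` with `deg u + N′ ≤ n · N` (the dehomogenisation of `a · M ^ n = U · M′`,
`deg U = nN − N′`) and `a ≠ 0` — print's "finite set of prime numbers `Σ`" is the set of primes
of `a`. Then, for every point `y = (x : 1)` of `ℙ¹` over any number field `F`:

* `NFPoint.condSupportDiv_subset_of_C_mul_pow_eq_mul` — `supp (D′_y)_red ⊆ supp (D_y)_red ∪
  {w ∣ a}` (at a prime `w ∤ a`, `ord_w M′(y) > 0 ⟹ ord_w M(y) > 0` in `w`-primitive coordinates);
* `NFPoint.logCondDiv_le_logCondDiv_add_log` — off `D ∪ D′`: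
  `log-cond_{D′}(y) ≤ log-cond_D(y) + log |a|` (the primes of `F` above `a` have
  `∏ N(w) ≤ |N_{F/ℚ}(a)| = |a|^{[F:ℚ]}`, and `log-cond` is normalised by `1/[F:ℚ]`);
* `NFPoint.bdLe_logCondDiv_of_C_mul_pow_eq_mul` — the BD-inequality `log-cond_{D′} ≲ log-cond_D`
  on every set of points off `D ∪ D′`, and, given certificates in both directions,
  `NFPoint.bdEquiv_logCondDiv_of_C_mul_pow_eq_mul` — **`[log-cond_D] = [log-cond_{D′}]`**, i.e.
  Rmk. 1.5.1 for `ℙ¹`;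
* non-vacuity: the cusps `C = [0]+[1]+[∞]` in the reduced model `m = t² − t` (`P1Divisor.cusps`)
  and in the non-reduced-over-`ℤ` model `m′ = 2t² − 2t` (same `C_ℚ`, `Σ = {2}`):
  `NFPoint.bdEquiv_logCondDiv_cusps_two_mul_cusps`.

Classical and outside the IUT dispute; theorems only (abc-iut cell, campaign S, node GenEll:Rmk1.5.1).
`TODO(general form)`: arbitrary normal `ℤ`-proper `ℤ`-flat `(X, D)` ([GenEll] Def. 1.1, 1.5 (iv)).
-/

noncomputable section

open NumberField IsDedekindDomain Polynomial

namespace Literature.NumberTheory.DiophantineGeometry.GenEll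

section Places

variable {F : Type*} [Field F] [NumberField F]

/-- A finite place takes values `≤ 1` on (images of) rational integers. [folklore] -/
private theorem finitePlace_intCast_le_one' (w : FinitePlace F) (c : ℤ) : w (c : F) ≤ 1 := by
  -- adapted from `GenEllDivisorConductor` (abc-iut-S4), where it is private
  rw [← FinitePlace.mk_maximalIdeal w, FinitePlace.mk_apply,
    show (c : F) = algebraMap (𝓞 F) F (c : 𝓞 F) by rw [map_intCast]]
  exact FinitePlace.norm_le_one F w.maximalIdeal (c : 𝓞 F)

/-- `|c|_w < 1` at the finite place of the prime `w` iff the rational integer `c` lies in `w`.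
[folklore] -/
private theorem finitePlace_mk_intCast_lt_one_iff (w : HeightOneSpectrum (𝓞 F)) (c : ℤ) :
    FinitePlace.mk w (c : F) < 1 ↔ (c : 𝓞 F) ∈ w.asIdeal := by
  rw [FinitePlace.mk_apply, show (c : F) = algebraMap (𝓞 F) F (c : 𝓞 F) by rw [map_intCast]]
  exact FinitePlace.norm_lt_one_iff_mem F w (c : 𝓞 F)

/-- If finitely many distinct primes `v` of `𝓞 F` all contain `y ≠ 0`, then the product of their
norms is at most `|N(y)|` (their product divides `(y)`). [folklore] -/
private theorem prod_absNorm_le_natAbs_norm' {y : 𝓞 F} (hy : y ≠ 0)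
    (T : Finset (HeightOneSpectrum (𝓞 F))) (hT : ∀ v ∈ T, y ∈ v.asIdeal) :
    ∏ v ∈ T, Ideal.absNorm v.asIdeal ≤ (Algebra.norm ℤ y).natAbs := by
  -- adapted from `AbcWave0GranvilleStarkHeightProofs.prod_absNorm_le_natAbs_norm` (kept private
  -- here to avoid that module's complex-multiplication imports)
  classical
  have hdvd : (∏ v ∈ T, v.asIdeal) ∣ Ideal.span {y} := by
    refine Finset.prod_dvd_of_coprime ?_ fun v hv => Ideal.dvd_span_singleton.2 (hT v hv)
    intro v _ w _ hvw
    have hne : v.asIdeal ≠ w.asIdeal := fun h => hvw (HeightOneSpectrum.ext h)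
    exact Ideal.isCoprime_iff_sup_eq.2 (v.isMaximal.coprime_of_ne w.isMaximal hne)
  have hle : Ideal.span {y} ≤ ∏ v ∈ T, v.asIdeal := Ideal.le_of_dvd hdvd
  have h1 := Ideal.absNorm_dvd_absNorm_of_le hle
  rw [map_prod, Ideal.absNorm_span_singleton] at h1
  refine Nat.le_of_dvd ?_ h1
  rw [pos_iff_ne_zero, Int.natAbs_ne_zero, Algebra.norm_ne_zero_iff]
  exact hy

/-- `|N_{F/ℚ}(a)| = |a|^{[F:ℚ]}` for a rational integer `a`. [folklore] -/
private theorem natAbs_norm_intCast (a : ℤ) :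
    (Algebra.norm ℤ (a : 𝓞 F)).natAbs = a.natAbs ^ Module.finrank ℚ F := by
  rw [show (a : 𝓞 F) = algebraMap ℤ (𝓞 F) a from (eq_intCast (algebraMap ℤ (𝓞 F)) a).symm,
    Algebra.norm_algebraMap, Int.natAbs_pow, NumberField.RingOfIntegers.rank]

/-- The primes of `F` containing the rational integer `a ≠ 0` have `∏ N(w) ≤ |a|^{[F:ℚ]}`.
[folklore] -/
private theorem prod_absNorm_le_natAbs_pow {a : ℤ} (ha : a ≠ 0)
    (T : Finset (HeightOneSpectrum (𝓞 F))) (hT : ∀ v ∈ T, (a : 𝓞 F) ∈ v.asIdeal) :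
    ∏ v ∈ T, Ideal.absNorm v.asIdeal ≤ a.natAbs ^ Module.finrank ℚ F := by
  have hy : (a : 𝓞 F) ≠ 0 := by exact_mod_cast ha
  simpa only [natAbs_norm_intCast] using prod_absNorm_le_natAbs_norm' hy T hT

end Places

namespace NFPoint

variable {D D' : P1Divisor}

/-- **The supports of the conductors of two integral models of the same `ℚ`-divisor differ only
above the certificate's primes**: if `C a · m ^ n = u · m′` with `deg u + N′ ≤ n · N`, then for every
point `y = (x : 1)` and every prime `w` of its field with `|a|_w = 1`,
`w ∈ supp (D′_y)_red ⟹ w ∈ supp (D_y)_red`. (At such `w`: `|m′(x)|_w < max(|x|_w,1)^{N′}` gives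
`|m(x)|_w^n = |u(x)|_w · |m′(x)|_w < max(|x|_w,1)^{deg u + N′} ≤ (max(|x|_w,1)^N)^n`.)
[cite: MochizukiGenEll2010, Rmk 1.5.1 pp.8–9] -/
theorem condSupportDiv_subset_of_C_mul_pow_eq_mul (P : NFPoint) {a : ℤ} {n : ℕ} {u : ℤ[X]}
    (h : C a * D.poly ^ n = u * D'.poly) (hdeg : u.natDegree + D'.deg ≤ n * D.deg) :
    P.condSupportDiv D' ⊆ P.condSupportDiv D ∪ {w | FinitePlace.mk w (a : P.F) < 1} := by
  intro w hw
  by_cases ha : FinitePlace.mk w (a : P.F) < 1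
  · exact Or.inr ha
  left
  have ha1 : FinitePlace.mk w (a : P.F) = 1 :=
    le_antisymm (finitePlace_intCast_le_one' _ a) (not_lt.mp ha)
  rw [mem_condSupportDiv_iff_mk] at hw ⊢
  set M : ℝ := max (FinitePlace.mk w P.x) 1 with hM
  have hM1 : 1 ≤ M := le_max_right _ _
  have hM0 : 0 < M := one_pos.trans_le hM1
  -- evaluate the certificate at `x`
  have heval : (a : P.F) * (aeval P.x D.poly) ^ n = aeval P.x u * aeval P.x D'.poly := by
    have := congrArg (aeval P.x) h
    simpa only [map_mul, map_pow, aeval_C, eq_intCast, map_intCast] using this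
  have hu : FinitePlace.mk w (aeval P.x u) ≤ M ^ u.natDegree :=
    finitePlace_aeval_le _ u le_rfl P.x
  have hlt : FinitePlace.mk w (aeval P.x D.poly) ^ n < (M ^ D.deg) ^ n := by
    have h1 : FinitePlace.mk w ((a : P.F) * (aeval P.x D.poly) ^ n) =
        FinitePlace.mk w (aeval P.x D.poly) ^ n := by
      rw [map_mul, map_pow, ha1, one_mul]
    rw [← h1, heval, map_mul, ← pow_mul]
    calc FinitePlace.mk w (aeval P.x u) * FinitePlace.mk w (aeval P.x D'.poly)
        < M ^ u.natDegree * M ^ D'.deg :=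
          mul_lt_mul' hu hw (apply_nonneg _ _) (pow_pos hM0 _)
      _ = M ^ (u.natDegree + D'.deg) := (pow_add _ _ _).symm
      _ ≤ M ^ (D.deg * n) := pow_le_pow_right₀ hM1 (by rw [Nat.mul_comm]; exact hdeg)
  exact lt_of_pow_lt_pow_left₀ n (pow_nonneg hM0.le _) hlt

/-- **[GenEll] Rmk. 1.5.1 for `ℙ¹`, explicit form**: for two integral models with certificate
`C a · m ^ n = u · m′`, `deg u + N′ ≤ n · N`, `a ≠ 0`, and a point `y` off `D ∪ D′` presented over any
number field `F`, `log-cond_{D′}(y) ≤ log-cond_D(y) + log |a|` — the primes of `F` dividing `a`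
contribute at most `(1/[F:ℚ]) · log |N_{F/ℚ}(a)| = log |a|`.
[cite: MochizukiGenEll2010, Rmk 1.5.1 pp.8–9] -/
theorem logCondDiv_le_logCondDiv_add_log (P : NFPoint) {a : ℤ} (ha : a ≠ 0) {n : ℕ} {u : ℤ[X]}
    (h : C a * D.poly ^ n = u * D'.poly) (hdeg : u.natDegree + D'.deg ≤ n * D.deg)
    (hP : P.OffDiv D) (hP' : P.OffDiv D') :
    P.logCondDiv D' ≤ P.logCondDiv D + Real.log (a.natAbs : ℝ) := by
  classical
  have hfin := P.condSupportDiv_finite hP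
  have hfin' := P.condSupportDiv_finite hP'
  have hd : (0 : ℝ) < P.degree := Nat.cast_pos.mpr P.degree_pos
  have hdeg' : (Module.finrank ℚ P.F : ℝ) = P.degree := rfl
  have hN1 : ∀ v : HeightOneSpectrum (𝓞 P.F), 1 ≤ Ideal.absNorm v.asIdeal := fun v =>
    Nat.one_le_iff_ne_zero.mpr (by rw [Ne, Ideal.absNorm_eq_zero_iff]; exact v.ne_bot)
  -- the primes of `supp D′` dividing `a`
  set T := hfin'.toFinset.filter (fun w => FinitePlace.mk w (a : P.F) < 1) with hT
  have hTa : ∀ w ∈ T, (a : 𝓞 P.F) ∈ w.asIdeal := fun w hw =>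
    (finitePlace_mk_intCast_lt_one_iff w a).mp (Finset.mem_filter.mp hw).2
  -- `supp D′ ⊆ supp D ∪ T`
  have hsub : hfin'.toFinset ⊆ hfin.toFinset ∪ T := by
    intro w hw
    have hw' : w ∈ P.condSupportDiv D' := hfin'.mem_toFinset.mp hw
    rcases P.condSupportDiv_subset_of_C_mul_pow_eq_mul h hdeg hw' with h1 | h1
    · exact Finset.mem_union_left _ (hfin.mem_toFinset.mpr h1)
    · exact Finset.mem_union_right _ (Finset.mem_filter.mpr ⟨hw, h1⟩)
  -- the product over `supp D′` is at most the product over `supp D` times `|a|^{[F:ℚ]}`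
  have hprod : (∏ᶠ w ∈ P.condSupportDiv D', Ideal.absNorm w.asIdeal) ≤
      (∏ᶠ w ∈ P.condSupportDiv D, Ideal.absNorm w.asIdeal) * a.natAbs ^ Module.finrank ℚ P.F := by
    rw [finprod_mem_eq_finite_toFinset_prod _ hfin', finprod_mem_eq_finite_toFinset_prod _ hfin]
    calc ∏ w ∈ hfin'.toFinset, Ideal.absNorm w.asIdeal
        ≤ ∏ w ∈ hfin.toFinset ∪ T, Ideal.absNorm w.asIdeal :=
          Finset.prod_le_prod_of_subset_of_one_le' hsub fun w _ _ => hN1 w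
      _ ≤ (∏ w ∈ hfin.toFinset ∪ T, Ideal.absNorm w.asIdeal) *
            ∏ w ∈ hfin.toFinset ∩ T, Ideal.absNorm w.asIdeal :=
          Nat.le_mul_of_pos_right _ (Finset.prod_pos fun w _ => hN1 w)
      _ = (∏ w ∈ hfin.toFinset, Ideal.absNorm w.asIdeal) * ∏ w ∈ T, Ideal.absNorm w.asIdeal :=
          Finset.prod_union_inter
      _ ≤ (∏ w ∈ hfin.toFinset, Ideal.absNorm w.asIdeal) * a.natAbs ^ Module.finrank ℚ P.F :=
          Nat.mul_le_mul_left _ (prod_absNorm_le_natAbs_pow ha T hTa)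
  have hpos' : (0 : ℝ) < ((∏ᶠ w ∈ P.condSupportDiv D', Ideal.absNorm w.asIdeal : ℕ) : ℝ) := by
    rw [finprod_mem_eq_finite_toFinset_prod _ hfin']
    exact_mod_cast Finset.prod_pos fun v _ => hN1 v
  have hpos : (0 : ℝ) < ((∏ᶠ w ∈ P.condSupportDiv D, Ideal.absNorm w.asIdeal : ℕ) : ℝ) := by
    rw [finprod_mem_eq_finite_toFinset_prod _ hfin]
    exact_mod_cast Finset.prod_pos fun v _ => hN1 v
  have ha0 : (0 : ℝ) < (a.natAbs : ℝ) := by exact_mod_cast Int.natAbs_pos.mpr ha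
  have hlog : Real.log ((∏ᶠ w ∈ P.condSupportDiv D', Ideal.absNorm w.asIdeal : ℕ) : ℝ) ≤
      Real.log ((∏ᶠ w ∈ P.condSupportDiv D, Ideal.absNorm w.asIdeal : ℕ) : ℝ) +
        Module.finrank ℚ P.F * Real.log (a.natAbs : ℝ) := by
    rw [← Real.log_pow, ← Real.log_mul hpos.ne' (by positivity)]
    exact Real.log_le_log hpos' (by exact_mod_cast hprod)
  unfold logCondDiv
  rw [hdeg'] at hlog
  calc (P.degree : ℝ)⁻¹ * Real.log ((∏ᶠ w ∈ P.condSupportDiv D', Ideal.absNorm w.asIdeal : ℕ) : ℝ)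
      ≤ (P.degree : ℝ)⁻¹ * (Real.log ((∏ᶠ w ∈ P.condSupportDiv D, Ideal.absNorm w.asIdeal : ℕ) : ℝ)
          + P.degree * Real.log (a.natAbs : ℝ)) :=
        mul_le_mul_of_nonneg_left hlog (inv_nonneg.mpr hd.le)
    _ = (P.degree : ℝ)⁻¹ * Real.log ((∏ᶠ w ∈ P.condSupportDiv D, Ideal.absNorm w.asIdeal : ℕ) : ℝ)
          + Real.log (a.natAbs : ℝ) := by
        field_simp

/-- **[GenEll] Rmk. 1.5.1 for `ℙ¹`, BD-class form (one certificate)**: on every set of points off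
`D ∪ D′`, `log-cond_{D′} ≲ log-cond_D` (`BDLe`, Def. 1.2 (ii)), with constant `log |a|`.
[cite: MochizukiGenEll2010, Rmk 1.5.1 pp.8–9] -/
theorem bdLe_logCondDiv_of_C_mul_pow_eq_mul {a : ℤ} (ha : a ≠ 0) {n : ℕ} {u : ℤ[X]}
    (h : C a * D.poly ^ n = u * D'.poly) (hdeg : u.natDegree + D'.deg ≤ n * D.deg)
    {S : Set NFPoint} (hS : ∀ P ∈ S, P.OffDiv D) (hS' : ∀ P ∈ S, P.OffDiv D') :
    BDLe S (fun P => P.logCondDiv D') (fun P => P.logCondDiv D) :=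
  ⟨Real.log (a.natAbs : ℝ), fun P hP => by
    linarith [P.logCondDiv_le_logCondDiv_add_log ha h hdeg (hS P hP) (hS' P hP)]⟩

/-- **[GenEll] Rmk. 1.5.1 for `ℙ¹`**: two integral models `D`, `D′` of the same reduced divisor
over `ℚ` (certificates `C a · m ^ n = u · m′` and `C a′ · m′ ^ n′ = u′ · m` with the degree
bounds, `a, a′ ≠ 0`) have BD-EQUIVALENT log-conductors on every set of points off `D ∪ D′`:
`[log-cond_D] = [log-cond_{D′}]` — "the BD-class of `log-cond_D` … depends only on the pair of
`ℚ`-schemes `(X_ℚ, D_ℚ)`". [cite: MochizukiGenEll2010, Rmk 1.5.1 pp.8–9] -/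
theorem bdEquiv_logCondDiv_of_C_mul_pow_eq_mul {a : ℤ} (ha : a ≠ 0) {n : ℕ} {u : ℤ[X]}
    (h : C a * D.poly ^ n = u * D'.poly) (hdeg : u.natDegree + D'.deg ≤ n * D.deg)
    {a' : ℤ} (ha' : a' ≠ 0) {n' : ℕ} {u' : ℤ[X]}
    (h' : C a' * D'.poly ^ n' = u' * D.poly) (hdeg' : u'.natDegree + D.deg ≤ n' * D'.deg)
    {S : Set NFPoint} (hS : ∀ P ∈ S, P.OffDiv D) (hS' : ∀ P ∈ S, P.OffDiv D') :
    BDEquiv S (fun P => P.logCondDiv D) (fun P => P.logCondDiv D') :=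
  (bdLe_logCondDiv_of_C_mul_pow_eq_mul ha' h' hdeg' hS' hS).antisymm
    (bdLe_logCondDiv_of_C_mul_pow_eq_mul ha h hdeg hS hS')

end NFPoint

/-! ## Non-vacuity: the cusps in a model that is not reduced over `ℤ` -/

namespace NFPoint

/-- **Rmk. 1.5.1, non-vacuity instance**: the divisor `C = [0]+[1]+[∞]` of `ℙ¹_ℚ` in the reduced
integral model `m = t² − t`, `N = 3` (`P1Divisor.cusps`) and in the model `M′ = 2·T₀T₁(T₀ − T₁)`,
`m′ = 2t² − 2t`, `N = 3` — the same `ℚ`-divisor, a different `ℤ`-scheme (its fibre at `2` is all of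
`ℙ¹_{𝔽₂}`); certificates `C 2 · m = 1 · m′` and `C 1 · m′ = C 2 · m`. The two log-conductors are
BD-equivalent on every set of points off `C` (they differ by at most `log 2`, above the prime `2`).
[cite: MochizukiGenEll2010, Rmk 1.5.1 pp.8–9] -/
theorem bdEquiv_logCondDiv_cusps_two_mul_cusps {S : Set NFPoint}
    (hS : ∀ P ∈ S, P.OffDiv P1Divisor.cusps) :
    BDEquiv S (fun P => P.logCondDiv P1Divisor.cusps)
      (fun P => P.logCondDiv ⟨C 2 * (X ^ 2 - X), 3,
        (natDegree_C_mul_le _ _).trans ((natDegree_sub_le _ _).trans (by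
          rw [natDegree_X_pow, natDegree_X]; norm_num))⟩) := by
  have hS' : ∀ P ∈ S, P.OffDiv ⟨C 2 * (X ^ 2 - X), 3,
      (natDegree_C_mul_le _ _).trans ((natDegree_sub_le _ _).trans (by
        rw [natDegree_X_pow, natDegree_X]; norm_num))⟩ := by
    intro P hP
    have h := hS P hP
    simp only [OffDiv, P1Divisor.cusps, ne_eq] at h ⊢
    rw [map_mul, aeval_C, eq_intCast, mul_eq_zero, not_or]
    exact ⟨by norm_num, h⟩
  refine bdEquiv_logCondDiv_of_C_mul_pow_eq_mul (a := 2) (by norm_num) (n := 1) (u := 1) ?_ ?_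
    (a' := 1) (by norm_num) (n' := 1) (u' := C 2) ?_ ?_ hS hS'
  · show C (2 : ℤ) * (X ^ 2 - X) ^ 1 = 1 * (C 2 * (X ^ 2 - X)); ring
  · show (1 : ℤ[X]).natDegree + 3 ≤ 1 * 3; rw [natDegree_one]
  · show C (1 : ℤ) * (C 2 * (X ^ 2 - X)) ^ 1 = C 2 * (X ^ 2 - X); rw [map_one, one_mul, pow_one]
  · show (C (2 : ℤ)).natDegree + 3 ≤ 1 * 3; rw [natDegree_C]

end NFPoint

end Literature.NumberTheory.DiophantineGeometry.GenEll

end
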